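import Literature.AlgebraicGeometry.HodgeTheory.UnitaryReflectionPairInfinite
import HarnessLib

/-!
# Unitary reflection groups along one orbit of roots: the root projectors, component closure under
# `Ad` of a reflection, and `Γ`-irreducibility (Carlson–Toledo 1999 §7, Theorem `udensitytheo` —
# algebraic proof, part 1)

Family `hodge`, layer `Literature/AlgebraicGeometry/HodgeTheory`. THEOREMS only (no definition, no named
fact). First part of an ALGEBRAIC proof of Carlson–Toledo's density theorem for unitary reflection groups
(the tree's named fact `carlsonToledo1999_unitaryReflection_zariskiDense`, file
`UnitaryReflectionGroupZariskiDense`; printed proof: Duke Math. J. 97 (1999) §7, pp. 15–16, by a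
semi-algebraic / hyperbolic-geometric argument adapting Deligne, Weil II §4.4). The algebraic proof replaces
orbits-with-interior by the LIE ALGEBRA `L` of the identity component of the Zariski closure of the
reflection group `Γ`: `L ⊆ 𝔰𝔩(W)` is an `Ad(Γ)`-stable Lie subalgebra, non-zero as soon as `Γ` is infinite,
and the heart of the matter (`UnitaryReflectionLieIrreducible`, `UnitaryReflectionLieCore`) is the purely
linear-algebraic statement

> for a reflection system (`Δ` a single `Γ`-orbit of unit roots spanning `W`, `λ ∉ {0, 1, -1}`), the only
> non-zero `Ad(Γ)`-stable Lie subalgebra of `𝔰𝔩(W)` is `𝔰𝔩(W)`.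

Setting: `W` a complex vector space with a sesquilinear form `B` (Mathlib convention, conjugate-linear in the
first variable; the source's `h(x,δ)` is `B δ x`), `ε` with `ε² = 1`, roots `δ ∈ Δ` with `B δ δ = ε`, the
complex `λ`-reflections `s_δ = complexReflection B ε λ δ = 1 + (λ - 1) π_δ` where `π_δ x = ε B δ x • δ`
(`π_δ = ε • (B δ).smulRight δ`, written inline throughout) is the idempotent onto `ℂδ` along
`δ^⊥ = ker (B δ)`, and `Γ` the subgroup of `GL(W)` generated by them. This file:

* §1 the calculus of `π_δ` (`rootProj_*`), `s_δ = 1 + (λ-1)π_δ`, `s_δ⁻¹ = 1 + (λ⁻¹-1)π_δ`, and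
  **component closure** `offDiag_mem_of_conj_mem`: a subspace `L ⊆ End(W)` stable under `Y ↦ s Y s⁻¹`
  (`s = 1 + (λ-1)π`, `π² = π`, `λ ∉ {0, ±1}`) contains with `Y` the two off-diagonal blocks `π Y (1-π)` and
  `(1-π) Y π` — the `Ad(s)`-eigencomponents for `λ`, `λ⁻¹` (a `3 × 3` Vandermonde in `1, λ, λ⁻¹`); they
  square to zero (`offDiag_mul_self`), and if both vanish `Y` commutes with `π`
  (`commute_of_offDiag_eq_zero`);
* §2 **`W` is `Γ`-irreducible** (`eq_bot_or_eq_top_of_forall_map_mem`): for `B` right-separating, `Δ`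
  spanning and `Γ`-transitive and `λ ≠ 1`, a `Γ`-stable subspace is `⊥` or `⊤` — it contains every root it
  is not orthogonal to (`s_δ x - x = ε(λ-1) B δ x • δ`), and transitivity forbids a proper split of `Δ`.

Written by the prover seat `hodge-nonav-prover-Bx` (cell `hodge-nonav`) for crux K1
`VeryGeneralDeckCommutatorsInHg` of `Summits/HodgeConjecture/HodgeConjecture/Theses/CyclicUnitaryPowers.lean`
(`stmt-HodgeConjecture-19544`), whose conditional proofs (`Theorems/CyclicUnitaryPowersFiveFacts`,
`…DeckHodgeOfGriffiths`) take the density theorem as a named hypothesis.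

## References
* [CarlsonToledo1999] J. A. Carlson, D. Toledo, *Discriminant complements and kernels of monodromy
  representations*, Duke Math. J. 97 (1999) 621–648, §7 Theorem `udensitytheo` (arXiv alg-geom/9708002
  p. 15), formula (reflectionconjugacy).
* [Deligne1980] P. Deligne, *La conjecture de Weil. II*, Publ. Math. IHÉS 52 (1980), §4.4 (the model:
  Lie algebra of the Zariski closure of a monodromy group generated by Picard–Lefschetz transformations).
-/

noncomputable section

open Module

namespace Literature.AlgebraicGeometry.HodgeTheory

/-! ### §1 The root projector `π_δ = ε • (B δ).smulRight δ` -/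

section Projector

variable {W : Type*} [AddCommGroup W] [Module ℂ W]

/-- `π_δ x = ε h(x,δ) δ`. [cite: CarlsonToledo1999, §7 Theorem udensitytheo] -/
theorem rootProj_apply (B : W →ₗ⋆[ℂ] W →ₗ[ℂ] ℂ) (ε : ℂ) (δ x : W) :
    (ε • (B δ).smulRight δ) x = (ε * B δ x) • δ := by
  simp [smul_smul]

/-- `π_δ δ = δ` when `h(δ,δ) = ε`, `ε² = 1`. [cite: CarlsonToledo1999, §7 Theorem udensitytheo] -/
theorem rootProj_apply_self (B : W →ₗ⋆[ℂ] W →ₗ[ℂ] ℂ) {ε : ℂ} (hε : ε * ε = 1) {δ : W} (hδ : B δ δ = ε) :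
    (ε • (B δ).smulRight δ) δ = δ := by
  rw [rootProj_apply, hδ, hε, one_smul]

/-- `π_δ x = 0` for `x ∈ δ^⊥`. [cite: CarlsonToledo1999, §7 Theorem udensitytheo] -/
theorem rootProj_apply_of_orthogonal (B : W →ₗ⋆[ℂ] W →ₗ[ℂ] ℂ) (ε : ℂ) {δ x : W} (hx : B δ x = 0) :
    (ε • (B δ).smulRight δ) x = 0 := by
  rw [rootProj_apply, hx, mul_zero, zero_smul]

/-- `π_δ` is idempotent (`h(δ,δ) = ε`, `ε² = 1`). [cite: CarlsonToledo1999, §7 Theorem udensitytheo] -/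
theorem rootProj_mul_self (B : W →ₗ⋆[ℂ] W →ₗ[ℂ] ℂ) {ε : ℂ} (hε : ε * ε = 1) {δ : W} (hδ : B δ δ = ε) :
    (ε • (B δ).smulRight δ) * (ε • (B δ).smulRight δ) = ε • (B δ).smulRight δ := by
  ext x
  rw [Module.End.mul_apply, rootProj_apply B ε δ x, map_smul, rootProj_apply_self B hε hδ]

/-- `1 - π_δ` maps into `δ^⊥ = ker h(·,δ)`. [cite: CarlsonToledo1999, §7 Theorem udensitytheo] -/
theorem apply_sub_rootProj_mem_ker (B : W →ₗ⋆[ℂ] W →ₗ[ℂ] ℂ) {ε : ℂ} (hε : ε * ε = 1) {δ : W}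
    (hδ : B δ δ = ε) (x : W) : B δ (x - (ε • (B δ).smulRight δ) x) = 0 := by
  rw [rootProj_apply, map_sub, map_smul, hδ, smul_eq_mul, mul_assoc, mul_comm (B δ x), ← mul_assoc, hε,
    one_mul, sub_self]

/-- The complex reflection is `s_δ = 1 + (λ - 1) π_δ`. [cite: CarlsonToledo1999, §7 Theorem udensitytheo] -/
theorem complexReflection_eq_one_add_smul_rootProj (B : W →ₗ⋆[ℂ] W →ₗ[ℂ] ℂ) (ε l : ℂ) (δ : W) :
    complexReflection B ε l δ = 1 + (l - 1) • (ε • (B δ).smulRight δ) := by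
  rw [complexReflection, smul_smul, mul_comm (l - 1) ε]
  rfl

/-- **Component closure.** If a subspace `L ⊆ End(W)` is stable under `Y ↦ s Y s'` with
`s = 1 + (λ-1)π`, `s' = 1 + (λ⁻¹-1)π`, `π² = π` and `λ ∉ {0, 1, -1}`, then it contains with `Y` the two
off-diagonal blocks `π Y (1 - π)` and `(1 - π) Y π` — the `Ad(s)`-eigencomponents of `Y` for the
eigenvalues `λ` and `λ⁻¹` (`s Y s' = Y + (λ-1)·πY(1-π) + (λ⁻¹-1)·(1-π)Yπ`, and the two blocks are
`Ad(s)`-eigenvectors; a Vandermonde elimination in the distinct nodes `1, λ, λ⁻¹`).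
[cite: CarlsonToledo1999, §7 Theorem udensitytheo] -/
theorem offDiag_mem_of_conj_mem {L : Submodule ℂ (Module.End ℂ W)} {π : Module.End ℂ W}
    (hπ : π * π = π) {l : ℂ} (hl0 : l ≠ 0) (hl1 : l ≠ 1) (hl2 : l * l ≠ 1)
    (hconj : ∀ Y ∈ L, (1 + (l - 1) • π) * Y * (1 + (l⁻¹ - 1) • π) ∈ L) {Y : Module.End ℂ W}
    (hY : Y ∈ L) : π * Y * (1 - π) ∈ L ∧ (1 - π) * Y * π ∈ L := by
  set m : ℂ := l⁻¹ with hm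
  have hlm : l * m = 1 := mul_inv_cancel₀ hl0
  set a : Module.End ℂ W := π * Y * (1 - π) with ha
  set b : Module.End ℂ W := (1 - π) * Y * π with hb
  set s : Module.End ℂ W := 1 + (l - 1) • π with hs
  set s' : Module.End ℂ W := 1 + (m - 1) • π with hs'
  -- conjugation is linear
  have hlin : ∀ (c d : ℂ) (Z Z' : Module.End ℂ W),
      s * (c • Z + d • Z') * s' = c • (s * Z * s') + d • (s * Z' * s') := by
    intro c d Z Z'
    simp only [mul_add, add_mul, mul_smul_comm, smul_mul_assoc]
  -- distributivity: the conjugate of any `Z`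
  have key : ∀ Z : Module.End ℂ W, s * Z * s' =
      Z + (l - 1) • (π * Z * (1 - π)) + (m - 1) • ((1 - π) * Z * π)
        + ((l - 1) + (m - 1) + (l - 1) * (m - 1)) • (π * Z * π) := by
    intro Z
    simp only [hs, hs', add_mul, mul_add, sub_mul, mul_sub, one_mul, mul_one, smul_mul_assoc,
      mul_smul_comm, mul_assoc]
    module
  have hcoef : (l - 1) + (m - 1) + (l - 1) * (m - 1) = 0 := by linear_combination hlm
  have key' : ∀ Z : Module.End ℂ W, s * Z * s' =
      Z + (l - 1) • (π * Z * (1 - π)) + (m - 1) • ((1 - π) * Z * π) := by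
    intro Z; rw [key, hcoef, zero_smul, add_zero]
  -- the idempotent relations
  have hπa : π * a = a := by rw [ha, ← mul_assoc, ← mul_assoc, hπ]
  have haπ : a * π = 0 := by rw [ha, mul_assoc (π * Y), sub_mul, one_mul, hπ, sub_self, mul_zero]
  have hπb : π * b = 0 := by
    rw [hb, ← mul_assoc, ← mul_assoc, mul_sub, mul_one, hπ, sub_self, zero_mul, zero_mul]
  have hbπ : b * π = b := by rw [hb, mul_assoc ((1 - π) * Y), hπ]
  -- `a` and `b` are eigenvectors of the conjugation
  have ha_conj : s * a * s' = l • a := by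
    rw [key' a]
    have h1 : π * a * (1 - π) = a := by rw [hπa, mul_sub, mul_one, haπ, sub_zero]
    have h2 : (1 - π) * a * π = 0 := by rw [mul_assoc, haπ, mul_zero]
    rw [h1, h2, smul_zero, add_zero]
    module
  have hb_conj : s * b * s' = m • b := by
    rw [key' b]
    have h1 : π * b * (1 - π) = 0 := by rw [hπb, zero_mul]
    have h2 : (1 - π) * b * π = b := by rw [sub_mul, one_mul, hπb, sub_zero, hbπ]
    rw [h1, h2, smul_zero, add_zero]
    module
  -- eliminate (Vandermonde in `1, l, m`)
  have hD1 : (l - 1) • a + (m - 1) • b ∈ L := by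
    have h := hconj Y hY
    rw [key' Y, ← ha, ← hb, add_assoc] at h
    have h' := L.sub_mem h hY
    rwa [add_sub_cancel_left] at h'
  have hD2 : ((l - 1) * l) • a + ((m - 1) * m) • b ∈ L := by
    have h := hconj _ hD1
    rwa [hlin, ha_conj, hb_conj, smul_smul, smul_smul] at h
  have haL : ((l - 1) * (l - m)) • a ∈ L := by
    have h := L.sub_mem hD2 (L.smul_mem m hD1)
    have e : ((l - 1) * l) • a + ((m - 1) * m) • b - m • ((l - 1) • a + (m - 1) • b) =
        ((l - 1) * (l - m)) • a := by module
    rwa [e] at h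
  have hbL : ((m - 1) * (m - l)) • b ∈ L := by
    have h := L.sub_mem hD2 (L.smul_mem l hD1)
    have e : ((l - 1) * l) • a + ((m - 1) * m) • b - l • ((l - 1) • a + (m - 1) • b) =
        ((m - 1) * (m - l)) • b := by module
    rwa [e] at h
  have hlm' : l - m ≠ 0 := by
    intro h
    apply hl2
    rw [← hlm, ← sub_eq_zero.1 h]
  have hm1 : m - 1 ≠ 0 := by
    intro h
    apply hl1
    have hm1' : m = 1 := sub_eq_zero.1 h
    rw [hm1', mul_one] at hlm
    exact hlm
  refine ⟨?_, ?_⟩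
  · have h := L.smul_mem ((l - 1) * (l - m))⁻¹ haL
    rwa [smul_smul, inv_mul_cancel₀ (mul_ne_zero (sub_ne_zero.2 hl1) hlm'), one_smul] at h
  · have h := L.smul_mem ((m - 1) * (m - l))⁻¹ hbL
    rwa [smul_smul, inv_mul_cancel₀ (mul_ne_zero hm1 (fun h => hlm' (by linear_combination -h))),
      one_smul] at h

/-- The two off-diagonal blocks square to zero. [cite: CarlsonToledo1999, §7 Theorem udensitytheo] -/
theorem offDiag_mul_self {π : Module.End ℂ W} (hπ : π * π = π) (Y : Module.End ℂ W) :
    π * Y * (1 - π) * (π * Y * (1 - π)) = 0 ∧ (1 - π) * Y * π * ((1 - π) * Y * π) = 0 := by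
  have h0 : (1 - π) * π = 0 := by rw [sub_mul, one_mul, hπ, sub_self]
  have h0' : π * (1 - π) = 0 := by rw [mul_sub, mul_one, hπ, sub_self]
  refine ⟨?_, ?_⟩
  · rw [mul_assoc (π * Y) (1 - π), ← mul_assoc (1 - π) (π * Y), ← mul_assoc (1 - π) π, h0, zero_mul,
      zero_mul, mul_zero]
  · rw [mul_assoc ((1 - π) * Y) π, ← mul_assoc π ((1 - π) * Y), ← mul_assoc π (1 - π), h0', zero_mul,
      zero_mul, mul_zero]

/-- If both off-diagonal blocks of `Y` vanish then `Y` commutes with `π`.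
[cite: CarlsonToledo1999, §7 Theorem udensitytheo] -/
theorem commute_of_offDiag_eq_zero {π Y : Module.End ℂ W} (ha : π * Y * (1 - π) = 0)
    (hb : (1 - π) * Y * π = 0) : π * Y = Y * π := by
  rw [mul_sub, mul_one, sub_eq_zero] at ha
  rw [sub_mul, one_mul, sub_mul, sub_eq_zero] at hb
  rw [ha, hb]

/-- `g (g⁻¹ x) = x` in `GL(W)`. [cite: CarlsonToledo1999, §7 (reflectionconjugacy)] -/
theorem linearEquiv_apply_inv_apply (g : W ≃ₗ[ℂ] W) (x : W) : g (g⁻¹ x) = x := g.apply_symm_apply x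

/-- `g⁻¹ (g x) = x` in `GL(W)`. [cite: CarlsonToledo1999, §7 (reflectionconjugacy)] -/
theorem linearEquiv_inv_apply_apply (g : W ≃ₗ[ℂ] W) (x : W) : g⁻¹ (g x) = x := g.symm_apply_apply x

/-- The inverse of a reflection `g` (`⇑g = s^λ_δ`) is `1 + (λ⁻¹ - 1)π_δ` as an endomorphism.
[cite: CarlsonToledo1999, §7 Theorem udensitytheo] -/
theorem coe_inv_eq_one_add_smul_rootProj (B : W →ₗ⋆[ℂ] W →ₗ[ℂ] ℂ) {ε : ℂ} (hε : ε * ε = 1) {l : ℂ}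
    (hl : l ≠ 0) {δ : W} (hδ : B δ δ = ε) {g : W ≃ₗ[ℂ] W}
    (hg : (g : W →ₗ[ℂ] W) = complexReflection B ε l δ) :
    ((g⁻¹ : W ≃ₗ[ℂ] W) : W →ₗ[ℂ] W) = 1 + (l⁻¹ - 1) • (ε • (B δ).smulRight δ) := by
  rw [coe_inv_eq_complexReflection B hε hl hδ hg, complexReflection_eq_one_add_smul_rootProj]

end Projector

/-! ### §2 `Γ`-irreducibility of `W` -/

section GammaIrreducible

variable {W : Type*} [AddCommGroup W] [Module ℂ W]

/-- **`W` is `Γ`-irreducible.** Let `B` be right-separating, `Δ` a set of vectors spanning `W` on which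
`Γ ≤ GL(W)` acts transitively (`ε ≠ 0`), and suppose `Γ` contains for every root an element
acting as the `λ`-reflection `s_δ`, `λ ≠ 1`. Then a `Γ`-stable subspace is `⊥` or `⊤`: it contains every
root it is not orthogonal to (`s_δ x - x = ε(λ-1) B δ x • δ`), the roots split into those inside and
those orthogonal, transitivity forbids a proper split, and `⋂ δ^⊥ = 0`.
[cite: CarlsonToledo1999, §7 Theorem udensitytheo] -/
theorem eq_bot_or_eq_top_of_forall_map_mem {B : W →ₗ⋆[ℂ] W →ₗ[ℂ] ℂ} (hBr : B.SeparatingRight)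
    {ε : ℂ} (hε0 : ε ≠ 0) {l : ℂ} (hl1 : l ≠ 1) {Δ : Set W} (hspan : Submodule.span ℂ Δ = ⊤)
    {Γ : Subgroup (W ≃ₗ[ℂ] W)} (hgen : ∀ δ ∈ Δ, ∃ g ∈ Γ, (g : W →ₗ[ℂ] W) = complexReflection B ε l δ)
    (htrans : ∀ δ ∈ Δ, ∀ δ' ∈ Δ, ∃ g ∈ Γ, g δ = δ') {U : Submodule ℂ W}
    (hU : ∀ g ∈ Γ, ∀ x ∈ U, g x ∈ U) : U = ⊥ ∨ U = ⊤ := by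
  classical
  -- a root not orthogonal to `U` lies in `U`
  have hroot : ∀ δ ∈ Δ, (∃ x ∈ U, B δ x ≠ 0) → δ ∈ U := by
    rintro δ hδ ⟨x, hxU, hx⟩
    obtain ⟨g, hgΓ, hg⟩ := hgen δ hδ
    have h1 : g x - x ∈ U := U.sub_mem (hU g hgΓ x hxU) hxU
    have h2 : g x - x = (ε * (l - 1) * B δ x) • δ := by
      rw [← LinearEquiv.coe_coe, hg, complexReflection_apply, add_sub_cancel_left]
    rw [h2] at h1
    have hc : ε * (l - 1) * B δ x ≠ 0 := mul_ne_zero (mul_ne_zero hε0 (sub_ne_zero.2 hl1)) hx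
    have h3 := U.smul_mem (ε * (l - 1) * B δ x)⁻¹ h1
    rwa [smul_smul, inv_mul_cancel₀ hc, one_smul] at h3
  by_cases hall : ∀ δ ∈ Δ, ∀ x ∈ U, B δ x = 0
  · -- `U ⊆ ⋂ δ^⊥ = 0`
    left
    rw [Submodule.eq_bot_iff]
    intro x hxU
    refine hBr x fun y => ?_
    have hy : y ∈ Submodule.span ℂ Δ := by rw [hspan]; exact Submodule.mem_top
    induction hy using Submodule.span_induction with
    | mem δ hδ => exact hall δ hδ x hxU
    | zero => simp
    | add y z _ _ hy hz => simp [map_add, hy, hz]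
    | smul c y _ hy => simp [LinearMap.map_smulₛₗ, hy]
  · right
    push Not at hall
    obtain ⟨δ₀, hδ₀, x, hxU, hx⟩ := hall
    have hδ₀U : δ₀ ∈ U := hroot δ₀ hδ₀ ⟨x, hxU, hx⟩
    -- every root lies in `U`, by transitivity
    have hallU : ∀ δ ∈ Δ, δ ∈ U := by
      intro δ hδ
      obtain ⟨g, hgΓ, hg⟩ := htrans δ₀ hδ₀ δ hδ
      rw [← hg]
      exact hU g hgΓ δ₀ hδ₀U
    rw [eq_top_iff, ← hspan, Submodule.span_le]
    exact hallU

end GammaIrreducible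

end Literature.AlgebraicGeometry.HodgeTheory
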